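import Summits.CriticalPhenomena.PercolationContinuityZ3.Theorems.PercNearOneGluingNoHeavyLowerTailFrontierDecRowsRow44CutVertex
import HarnessLib

/-!
# Deleting the far side of a cut vertex does not change group-separation rows read on the near side

Support file for crux `stmt-CriticalPhenomena-4575` (four-point decreasing `E₃` frontier; the cut-vertex reduction of row 44, memo
`run/shared/lean/prim/prim-l12/FROM-prim-l12-p6-g15-ROW44-CUT-VERTICES.md` §3), seat `prim-l12-p6` gen 15.  No definitions, no named
facts, no sorries.

If every positive-weight edge avoiding `h` joins two vertices of the same colour (`side`), and all the terminals of three group-separation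
events are coloured `true` (or equal to `h`), then Sahi's functional `E₃` of the three events is the same under `w` and under the weight
`w` restricted to the edges inside the `true` side (all other edges set to `0`): `sahiE3_sep_restrictSide`.  This is the bookkeeping step
of the induction "a vertex-minimal counterexample to row 44 has no cut vertex": after `sahiE3_row44_nonneg_of_threeOneCut` replaces the
lone terminal by `h`, the far side carries no terminal and can be deleted.  Ingredients: thinning to the support
(`real_eq_real_setOf_inter_mem`), the glued-graph lemma `reachable_sup_iff_left`, and `prodBernoulli_map_inter`.
-/

noncomputable section

namespace Summit.CriticalPhenomena.PercolationContinuityZ3.Theorems.FrontierDecRows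

open MeasureTheory CovTransferCert E3GroupSepCert
open Literature.Probability.Percolation Literature.Probability.LatticeModels

variable {n : ℕ}

/-- **Restriction to the near side of a cut vertex.**  With `F₁` = the edges all of whose endpoints are coloured `true` or equal to
`h`: if every positive-weight edge avoiding `h` is monochromatic and the terminals of the three separation events are `true` or `h`,
then `E₃` under `w` equals `E₃` under `w` restricted to `F₁`. [this work] -/
theorem sahiE3_sep_restrictSide (w : Sym2 (Fin n) → unitInterval) (h : Fin n) (side : Fin n → Bool)
    (hw : ∀ u v : Fin n, u ≠ h → v ≠ h → side u ≠ side v → w s(u, v) = 0)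
    (X₁ Y₁ X₂ Y₂ X₃ Y₃ : List (Fin n))
    (hpts : ∀ x ∈ X₁ ++ Y₁ ++ X₂ ++ Y₂ ++ X₃ ++ Y₃, side x = true ∨ x = h) :
    sahiE3 (prodBernoulli w) (connEvent (sep X₁ Y₁)) (connEvent (sep X₂ Y₂)) (connEvent (sep X₃ Y₃)) =
      sahiE3 (prodBernoulli (fun e => if e ∈ (↑(Finset.univ.filter (fun e : Sym2 (Fin n) => ∀ u ∈ e, side u = true ∨ u = h)) :
          Set (Sym2 (Fin n))) then w e else 0))
        (connEvent (sep X₁ Y₁)) (connEvent (sep X₂ Y₂)) (connEvent (sep X₃ Y₃)) := by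
  classical
  set F₁ : Finset (Sym2 (Fin n)) := Finset.univ.filter (fun e => ∀ u ∈ e, side u = true ∨ u = h) with hF₁
  set F₂ : Finset (Sym2 (Fin n)) :=
    Finset.univ.filter (fun e => (∀ u ∈ e, side u = false ∨ u = h) ∧ ¬ ∀ u ∈ e, u = h) with hF₂
  set μ := prodBernoulli w with hμ
  set w' : Sym2 (Fin n) → unitInterval := fun e => if e ∈ (↑F₁ : Set (Sym2 (Fin n))) then w e else 0 with hw'
  set μ' := prodBernoulli w' with hμ'
  have mem₁ : ∀ e, e ∈ F₁ ↔ ∀ u ∈ e, side u = true ∨ u = h := fun e => by rw [hF₁, Finset.mem_filter]; simp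
  have mem₂ : ∀ e, e ∈ F₂ ↔ (∀ u ∈ e, side u = false ∨ u = h) ∧ ¬ ∀ u ∈ e, u = h := fun e => by
    rw [hF₂, Finset.mem_filter]; simp
  set D : Finset (Sym2 (Fin n)) := F₁ ∪ F₂ with hD
  have hwD : ∀ e, e ∉ D → w e = 0 := by
    intro e he
    rw [hD, Finset.mem_union, not_or, mem₁, mem₂] at he
    obtain ⟨h1, h2⟩ := he
    induction e using Sym2.ind with
    | h u v =>
      have key : u ≠ h ∧ v ≠ h ∧ side u ≠ side v := by
        by_cases hu : u = h
        · subst hu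
          exfalso
          by_cases hv : v = u
          · exact h1 fun x hx => Or.inr (by rcases Sym2.mem_iff.1 hx with e | e <;> [exact e; exact e.trans hv])
          · cases hsv : side v
            · exact h2 ⟨fun x hx => by rcases Sym2.mem_iff.1 hx with e | e <;> [exact Or.inr e; exact Or.inl (e ▸ hsv)],
                fun hall => hv (hall v (Sym2.mem_iff.2 (Or.inr rfl)))⟩
            · exact h1 fun x hx => by rcases Sym2.mem_iff.1 hx with e | e <;> [exact Or.inr e; exact Or.inl (e ▸ hsv)]
        · by_cases hv : v = h
          · subst hv
            exfalso
            cases hsu : side u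
            · exact h2 ⟨fun x hx => by rcases Sym2.mem_iff.1 hx with e | e <;> [exact Or.inl (e ▸ hsu); exact Or.inr e],
                fun hall => hu (hall u (Sym2.mem_iff.2 (Or.inl rfl)))⟩
            · exact h1 fun x hx => by rcases Sym2.mem_iff.1 hx with e | e <;> [exact Or.inl (e ▸ hsu); exact Or.inr e]
          · refine ⟨hu, hv, fun hse => ?_⟩
            cases hsu : side u
            · exact h2 ⟨fun x hx => by
                  rcases Sym2.mem_iff.1 hx with e | e <;> [exact Or.inl (e ▸ hsu); exact Or.inl (e ▸ (hse ▸ hsu))],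
                fun hall => hu (hall u (Sym2.mem_iff.2 (Or.inl rfl)))⟩
            · exact h1 fun x hx => by
                rcases Sym2.mem_iff.1 hx with e | e <;> [exact Or.inl (e ▸ hsu); exact Or.inl (e ▸ (hse ▸ hsu))]
      exact hw u v key.1 key.2.1 key.2.2
  have hT : ∀ ω : Set (Sym2 (Fin n)), ∀ v u u', (openGraph (ω ∩ ↑F₁)).Adj v u → (openGraph (ω ∩ ↑F₂)).Adj v u' → v = h := by
    intro ω v u u' h1 h2
    rw [openGraph_adj] at h1 h2
    have e1 := (mem₁ _).1 (Finset.mem_coe.1 h1.1.2) v (Sym2.mem_iff.2 (Or.inl rfl))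
    have e2 := ((mem₂ _).1 (Finset.mem_coe.1 h2.1.2)).1 v (Sym2.mem_iff.2 (Or.inl rfl))
    rcases e1 with e1 | e1
    · rcases e2 with e2 | e2
      · rw [e1] at e2; exact absurd e2 (by decide)
      · exact e2
    · exact e1
  have iso₂ : ∀ ω : Set (Sym2 (Fin n)), ∀ x, (side x = true ∨ x = h) → x ≠ h → ∀ u, ¬ (openGraph (ω ∩ ↑F₂)).Adj x u := by
    intro ω x hx hxh u hadj
    rw [openGraph_adj] at hadj
    rcases ((mem₂ _).1 (Finset.mem_coe.1 hadj.1.2)).1 x (Sym2.mem_iff.2 (Or.inl rfl)) with e | e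
    · rcases hx with hx | hx
      · rw [hx] at e; exact Bool.noConfusion e
      · exact hxh hx
    · exact hxh e
  have hsup : ∀ ω : Set (Sym2 (Fin n)), openGraph (ω ∩ ↑D) = openGraph (ω ∩ ↑F₁) ⊔ openGraph (ω ∩ ↑F₂) := by
    intro ω
    rw [hD, Finset.coe_union, Set.inter_union_distrib_left]
    exact SimpleGraph.fromEdgeSet_union _ _
  -- near-side pairs: reachability in the thinned configuration is reachability inside `F₁`
  have pl : ∀ ω : Set (Sym2 (Fin n)), ∀ x z, (side x = true ∨ x = h) → (side z = true ∨ z = h) →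
      ((openGraph (ω ∩ ↑D)).Reachable x z ↔ (openGraph (ω ∩ ↑F₁)).Reachable x z) := by
    intro ω x z hx hz
    rw [hsup ω]
    exact reachable_sup_iff_left (hT ω) (iso₂ ω x hx) (iso₂ ω z hz)
  -- translation of a near-side separation event
  have tSep : ∀ X Y : List (Fin n), (∀ x ∈ X ++ Y, side x = true ∨ x = h) →
      {ω : Set (Sym2 (Fin n)) | ω ∩ ↑D ∈ connEvent (sep X Y)} = {ω | ω ∩ ↑F₁ ∈ connEvent (sep X Y)} := by
    intro X Y hXY
    ext ω
    simp only [Set.mem_setOf_eq, mem_connEvent_sep, openConn]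
    refine forall₂_congr fun x hx => forall₂_congr fun z hz => ?_
    exact not_congr (pl ω x z (hXY x (List.mem_append.2 (Or.inl hx))) (hXY z (List.mem_append.2 (Or.inr hz))))
  have h1 : ∀ x ∈ X₁ ++ Y₁, side x = true ∨ x = h := fun x hx => hpts x (by simp only [List.mem_append] at hx ⊢; tauto)
  have h2 : ∀ x ∈ X₂ ++ Y₂, side x = true ∨ x = h := fun x hx => hpts x (by simp only [List.mem_append] at hx ⊢; tauto)
  have h3 : ∀ x ∈ X₃ ++ Y₃, side x = true ∨ x = h := fun x hx => hpts x (by simp only [List.mem_append] at hx ⊢; tauto)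
  set E₁ := connEvent (sep X₁ Y₁) with hE₁
  set E₂ := connEvent (sep X₂ Y₂) with hE₂
  set E₃ := connEvent (sep X₃ Y₃) with hE₃
  -- `μ' S = μ {ω | ω ∩ F₁ ∈ S}` for every `S`
  have hmap : μ' = μ.map (fun ξ : Set (Sym2 (Fin n)) => ξ ∩ ↑F₁) := by
    rw [hμ', hμ, prodBernoulli_map_inter w (↑F₁ : Set (Sym2 (Fin n)))]
  have ms : ∀ A : Set (Set (Sym2 (Fin n))), MeasurableSet A := fun A => (Set.toFinite _).measurableSet
  have hf : Measurable (fun ξ : Set (Sym2 (Fin n)) => ξ ∩ ↑F₁) :=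
    measurable_set_iff.2 fun i => (measurable_set_mem i).and measurable_const
  have eμ' : ∀ S : Set (Set (Sym2 (Fin n))), μ'.real S = μ.real {ω | ω ∩ ↑F₁ ∈ S} := by
    intro S
    simp only [Measure.real, hmap, Measure.map_apply hf (ms S)]
    rfl
  -- `μ S = μ {ω | ω ∩ F₁ ∈ S}` for near-side events (thinning + translation)
  have thin : ∀ A : Set (Set (Sym2 (Fin n))), μ.real A = μ.real {ω | ω ∩ ↑D ∈ A} :=
    fun A => real_eq_real_setOf_inter_mem w D hwD A
  have pre_inter : ∀ (G : Finset (Sym2 (Fin n))) (P Q : Set (Set (Sym2 (Fin n)))),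
      {ω : Set (Sym2 (Fin n)) | ω ∩ ↑G ∈ P ∩ Q} = {ω | ω ∩ ↑G ∈ P} ∩ {ω | ω ∩ ↑G ∈ Q} := fun G P Q => rfl
  have t1 := tSep X₁ Y₁ h1
  have t2 := tSep X₂ Y₂ h2
  have t3 := tSep X₃ Y₃ h3
  have key : ∀ S : Set (Set (Sym2 (Fin n))),
      {ω : Set (Sym2 (Fin n)) | ω ∩ ↑D ∈ S} = {ω | ω ∩ ↑F₁ ∈ S} → μ.real S = μ'.real S := by
    intro S hS; rw [thin, hS, eμ']
  rw [sahiE3_def, sahiE3_def,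
    key (E₁ ∩ E₂ ∩ E₃) (by rw [pre_inter, pre_inter, pre_inter, pre_inter, t1, t2, t3]),
    key E₁ t1, key E₂ t2, key E₃ t3,
    key (E₂ ∩ E₃) (by rw [pre_inter, pre_inter, t2, t3]),
    key (E₁ ∩ E₃) (by rw [pre_inter, pre_inter, t1, t3]),
    key (E₁ ∩ E₂) (by rw [pre_inter, pre_inter, t1, t2])]

end Summit.CriticalPhenomena.PercolationContinuityZ3.Theorems.FrontierDecRows
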